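import Summits.QuantumFields.YangMills.Theorems.BalabanUVNodesN18AtRateRecord11
import Summits.QuantumFields.YangMills.Theorems.BalabanUVNodesN18TransportSwap
import Summits.QuantumFields.YangMills.Theorems.BalabanUVNodesRateCarriersOfRecord12
import Literature.MathematicalPhysics.QuantumFieldTheory.Balaban1983to89.Node00.HistoryTermsOfRecord

/-!
# BalabanUVNodes ∕ node N18 = NE5 — `S_N18` AT THE STAGE-12 RATE-RECORD HOME OF RECORD `YMDAG.UVSplit.RRec₁₂ 𝔯` (layer B at ₁₂): the ONE
# APPLICATION in the θ-form a definer proves (`θ : Stage12Params F N`, `hP : θ.Provisos₁₂ F N` — readings TAKE the provisos), for BOTH constructors of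
# record of the reading's U3 objects — FIXED-CARRIER (an END bundle carrying `N18At`, letters dominating; THE H-LAYER END WITH THE NODE-A MAJORANT AS
# HYPOTHESIS; through ANY transport of record at the booked price) and TOWER — the W1-currency reading, what the stub hands back, located vacuity

Cell `pub-ymgap`, HUMAN RULING D-0062 (Track A), R134 seat `pub-ymgap-dag-n18-d` (strategy s2: by-name knit at the record), generation 0, module 7 = THE ₁₂ TWIN of
module 5 (`BalabanUVNodesN18AtRateRecord11Home`, p459386 ✓ 5e50030558f4).  WHY A TWIN: node00-def-T's LOCATED-2 (pub-ymgap INBOX l.12862, 2026-08-26T17:16Z):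
`Stage11Params.Provisos₁₁` is UNINHABITED (`Node00.not_provisos₁₁`, `Node00.not_isRecordOfRecord₁₁C` — its field `alphaPos` quantified over junk runs), so
every ₁₁ datum key is empty and `S_N18 (RRec₁₁ 𝔯)` holds for EVERY reading with no estimate (n22-e's `k4_rRec₁₁_outright`); the content re-keys to def-T's
repaired Stage 12 (`Node00/Record12.lean`: `Stage12Params`, `Provisos₁₂` with `alphaPos` dropped and `bg` guarded by the window, `IsRecordOfRecord₁₂C`), RR-2's
`Node00/Record12DatumKey.lean` (`IsDatumOfRecord₁₂C` with `.params ∕ .provisos ∕ .admissible`) and n22-e's LAYER B AT ₁₂ (`BalabanUVNodesRateCarriersOfRecord12`: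
`RateReading₁₂` — `lit F θ hP g₀ os` — `u3OfRecord₁₂ θ u k`, `RRec₁₂ 𝔯`, `s_N18_rRec₁₂_iff`).  THEOREMS ONLY (0 `def`, 0 `sorry`, standard axioms); imports module 4
(p456073: the STAGE-FREE level-bundle faces `n18At_level_ofFixed_iff ∕ _of_mono ∕ _of_envelopeOnRecord`, `n18At_level_tower_of_comap_agree`), module 6 (p460812:
`n18At_of_transport_swap`), layer B at ₁₂, and W1's `Node00/HistoryTermsOfRecord` (p455641); modifies nothing; `--supports stmt-QuantumFields-19908 --as helper` (K3′ `SpineGivenEndpointR12`, rev 15; dag-lead WORDS-111 key table).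

THE SLOT.  `RRec₁₂ 𝔯 F D g₀ os R :↔ ∃ (h : IsDatumOfRecord₁₂C F N D) k, R = rateCarriersOfRecord₁₂ 𝔯 F h.params h.provisos g₀ os k`, whose U3 component is
`u3OfRecord₁₂ h.params (𝔯.lit F h.params h.provisos g₀ os).u3 k = ⟨u.levelCarriers k, Window θ.γ, θ.γ, u.κ, u.EA k, u.EB k, u.θ₅, u.C₅, u.moduli, …⟩` — module 4's
STAGE-FREE literal at `γ := θ.γ`, so every face below is ONE application of a module-4 ∕ module-6 theorem behind layer B's `s_N18_rRec₁₂_iff`: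
* §0 `n18At_u3OfRecord₁₂_iff` (`Iff.rfl`) · §1 `s_N18_rRec₁₂_of_forall_admissible` ∕ `_of_forall_ne5` (θ-form one application), `ne5_of_s_N18_rRec₁₂` (what N17's knit ∕
  N19's rate edge ∕ K4 get back at a datum key) · §2 `s_N18_rRec₁₂_of_ofFixed` ∕ `_of_ofFixed_mono` (fixed-carrier reading; letters of record dominating an END's) ·
  §3 THE ROW `s_N18_rRec₁₂_of_envelopeOnRecord` (the H-layer END with module 1's binder list VERBATIM — (2.13) `hrep`, THE NODE-A MAJORANT `hH` AS HYPOTHESIS, leaves,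
  located numerals, reach ∕ sharp clauses — on `W ⊇ ]0, θ.γ]^ℕ`, radius `γ′ ≥ θ.γ`, domination `ℓ.κ ≤ κ`, `θ′ ≤ ℓ.θ₅`, `C₅(C₃ε₁) ≤ ℓ.C₅`) · §4 `s_N18_rRec₁₂_of_tower` ·
  §5 located vacuity `s_N18_rRec₁₂_of_null` · §6 W1 currency `n18At_u3OfRecord₁₂_histCarriers_iff` (`Iff.rfl`: the η-rate inequality
  `|Re E_A^{(j)}(X; g; embA (tr U)) − Re E_B(πX; b∷g; embB U)| ≤ C₅·θ₅^j·e^{−κ d_j(X)}` for Bałaban's (2.13) terms on W1's `histCarriers`), `s_N18_rRec₁₂_of_histCarriers` ·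
  §7 `s_N18_rRec₁₂_of_ofFixed_transport_swap` (module 6 at the home: the END's NE5 may be known through ANOTHER transport `T′` — e.g. the datum's block averaging —
  than the one the definer's objects carry; price `D` booked into `C₅`) · §8 `datumCarriers_transport_of_isDatumOfRecord₁₂C` (at a Stage-12 datum key the
  datum-keyed two-run carriers transport run B's background by Bałaban's (0.4) block averaging `transportRaw F K (blockAvg expMeanLogSU)` — module 1 §3 re-keyed) ·
  §9 REFUTABILITY RESTORED AT ₁₂ MODULO K0′: `not_n18At_unit_gap_window` (decided toy) and `exists_not_s_N18_rRec₁₂_of_inhabited` — if some Stage-12 datum key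
  is inhabited, next to any reading there is one (U3 objects := the unit-gap bundle) over which `S_N18 (RRec₁₂ ·)` FAILS: unlike the empty ₁₁ home
  (`k4_rRec₁₁_outright`), the ₁₂ stub is not closed by shape.

HONEST FRAMING.  Kernel bookkeeping BY NAME; restates nothing; no Theses import.  The residual reading `𝔯` is a PARAMETER (W1 g2's named reading
`𝔯_W1 := RateReading₁₂.ofAssignment (Node00.W1.assignment₁₂ 𝔇) ne1`, `Node00/RateRecordW1Reading` p465810, is read in module 8 `BalabanUVNodesN18AtReadingW1`); the END binders of §3 (NODE A's (2.38) for Bałaban's (2.14)-term activities, `hrep`, NODE O's leaves) are instanced by nobody; NE5 is NOT IN PRINT for d = 4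
and NOT proved; K0′ (an inhabitant of `IsDatumOfRecord₁₂C`) open; N18 NOT discharged (discharged count of record unmoved).  One finite four-torus programme at fixed `ε`;
NOT infinite volume, NOT OS on ℝ⁴, NOT a mass gap, NOT Clay.
-/

noncomputable section

namespace YMDAG.N18.HLayer

open Literature.MathematicalPhysics.QuantumFieldTheory.Balaban1983to89
open Literature.MathematicalPhysics.QuantumFieldTheory.Balaban1983to89.T4Continuum
open Literature.MathematicalPhysics.QuantumFieldTheory.Balaban1983to89.T4OutputRate (Carriers Functional NE5 LipBackground Window)
open Literature.MathematicalPhysics.QuantumFieldTheory.Balaban1983to89.T4InputCauchyRateData (StepModel)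
open Literature.MathematicalPhysics.QuantumFieldTheory.Balaban1983to89.B13Resummation (locE)
open Literature.MathematicalPhysics.QuantumFieldTheory.Balaban1983to89.TreeLengthTorus (TDom tsys torusTreeLen)
open Literature.MathematicalPhysics.QuantumFieldTheory.Balaban1983to89.TreeLengthTorusGeometry (TTouch)
open Literature.MathematicalPhysics.QuantumFieldTheory.Balaban1983to89.B12TreeDecay (K₀)
open Literature.MathematicalPhysics.QuantumFieldTheory.Balaban1983to89.Node00 (Stage12Params IsDatumOfRecord₁₂C U3Letters₁₁ U3Objects₁₁
  U3Tower₁₁ prependCoupling)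
open Summit.QuantumFields.BalabanUV.T4Continuum.B13Carriers (TwoRuns transportRaw)
open YMDAG.N18.TransportSwap (n18At_of_transport_swap)
open Summit.QuantumFields.BalabanUV.T4Continuum.Spine.NE5
open YMDAG.UVSplit

variable {N : ℕ} [NeZero N]

/-! ## §0 The reading of N18 at the bundle of record -/

/-- **WHAT N18 SAYS AT THE BUNDLE OF RECORD** `u3OfRecord₁₂ θ u k` (`Iff.rfl`; module 4's `n18At_level_iff` at `γ := θ.γ`): for every member `b ∈ ]0, θ.γ]`
of run B's first-coupling family, the two-run η-rate `NE5 (u.EA k) (u.EB k b) (Window θ.γ) u.κ u.θ₅ u.C₅` on the level-`k` pair carriers — i.e.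
`|u.EA k g (transport U) X − u.EB k b g U X| ≤ u.C₅ · u.θ₅ ^ scale X · e^{−u.κ·d X}` for `g ∈ ]0, θ.γ]^ℕ`. [cite: Balaban1987RG1, Thm 1 p.259 and (1.18) p.263] -/
theorem n18At_u3OfRecord₁₂_iff {F : T4Family} (θ : Stage12Params F N) (u : U3Objects₁₁) (k : ℕ) :
    N18At (u3OfRecord₁₂ θ u k) ↔ ∀ b : ℝ, 0 < b → b ≤ θ.γ → NE5 (u.EA k) (u.EB k b) (Window θ.γ) u.κ u.θ₅ u.C₅ :=
  Iff.rfl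

/-! ## §1 The one application, θ-form; and what the stub hands back -/

variable (𝔯 : RateReading₁₂ N)

/-- **THE ONE APPLICATION, θ-FORM** [bookkeeping]: if at EVERY admissible Stage-11 tuple `θ` with provisos, every `(g₀, os)` and every run length `k` the
reading's bundle of record carries `N18At`, then `S_N18 (RRec₁₂ 𝔯)` — the datum key `h : IsDatumOfRecord₁₂C F N D` reads its objects at the canonical
`h.params`, which is admissible with provisos. [cite: Balaban1987RG1, Thm 1 p.259] -/
theorem s_N18_rRec₁₂_of_forall_admissible
    (h : ∀ (F : T4Family) (θ : Stage12Params F N) (hP : θ.Provisos₁₂ F N), θ.Admissible F N →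
      ∀ (g₀ : ℕ → ℝ) (os : List (ULoop F)) (k : ℕ), N18At (u3OfRecord₁₂ θ (𝔯.lit F θ hP g₀ os).u3 k)) :
    S_N18 (RRec₁₂ 𝔯) :=
  (s_N18_rRec₁₂_iff 𝔯).2 fun F _ hk g₀ os k => h F hk.params hk.provisos hk.admissible g₀ os k

/-- **THE ONE APPLICATION, NE5 SPELLED OUT** [bookkeeping]: NE5 for the reading's level functionals `u.EA k`, `u.EB k b` on `]0, θ.γ]^ℕ` at the letter
block's `(κ, θ₅, C₅)`, for every admissible tuple with provisos, every `(g₀, os)`, level `k` and member `b ∈ ]0, θ.γ]`, closes `S_N18 (RRec₁₂ 𝔯)`.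
[cite: Balaban1987RG1, Thm 1 p.259 and (1.18) p.263] -/
theorem s_N18_rRec₁₂_of_forall_ne5
    (h : ∀ (F : T4Family) (θ : Stage12Params F N) (hP : θ.Provisos₁₂ F N), θ.Admissible F N →
      ∀ (g₀ : ℕ → ℝ) (os : List (ULoop F)) (k : ℕ) (b : ℝ), 0 < b → b ≤ θ.γ →
        NE5 ((𝔯.lit F θ hP g₀ os).u3.EA k) ((𝔯.lit F θ hP g₀ os).u3.EB k b) (Window θ.γ) (𝔯.lit F θ hP g₀ os).u3.κ
          (𝔯.lit F θ hP g₀ os).u3.θ₅ (𝔯.lit F θ hP g₀ os).u3.C₅) :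
    S_N18 (RRec₁₂ 𝔯) :=
  s_N18_rRec₁₂_of_forall_admissible 𝔯 fun F θ hP hA g₀ os k => (n18At_u3OfRecord₁₂_iff θ _ k).2 (h F θ hP hA g₀ os k)

/-- **WHAT `S_N18 (RRec₁₂ 𝔯)` HANDS BACK AT A DATUM KEY** [bookkeeping] (N17's knit `N17_of_ne5_readOut`, N19's rate edge, K4 read it so): at every datum
of record, every `(g₀, os)`, level `k` and member `b ∈ ]0, θ.γ]` (θ = the canonical parameter), NE5 for the reading's level functionals on `]0, θ.γ]^ℕ` at
the letter block's `(κ, θ₅, C₅)`. [cite: Balaban1987RG1, Thm 1 p.259 and (1.18) p.263] -/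
theorem ne5_of_s_N18_rRec₁₂ (hS : S_N18 (RRec₁₂ 𝔯)) {F : T4Family} {D : Datum F N} (hk : IsDatumOfRecord₁₂C F N D) (g₀ : ℕ → ℝ)
    (os : List (ULoop F)) (k : ℕ) {b : ℝ} (hb : 0 < b) (hbγ : b ≤ hk.params.γ) :
    NE5 ((𝔯.lit F hk.params hk.provisos g₀ os).u3.EA k) ((𝔯.lit F hk.params hk.provisos g₀ os).u3.EB k b) (Window hk.params.γ)
      (𝔯.lit F hk.params hk.provisos g₀ os).u3.κ (𝔯.lit F hk.params hk.provisos g₀ os).u3.θ₅ (𝔯.lit F hk.params hk.provisos g₀ os).u3.C₅ :=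
  (n18At_u3OfRecord₁₂_iff hk.params _ k).1 ((s_N18_rRec₁₂_iff 𝔯).1 hS F D hk g₀ os k) b hb hbγ

/-! ## §2 The fixed-carrier reading at the home -/

/-- **FIXED CARRIERS AT THE HOME** [bookkeeping]: if at every admissible tuple with provisos and every `(g₀, os)` the reading's U3 objects ARE the fixed
bundle `U3Objects₁₁.ofFixed C EA EB ℓ` of one pair-carrier structure (W1's `histCarriers ∕ functional` shape, the H-layer END's `TwoRuns.carriers`) with
`N18At ⟨C, Window θ.γ, θ.γ, ℓ.κ, EA, EB, ℓ.θ₅, ℓ.C₅, …⟩`, then `S_N18 (RRec₁₂ 𝔯)` (module 4's `n18At_level_ofFixed_iff` at every level).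
[cite: Balaban1989LargeFieldII, (2.13)–(2.14) p.359; Balaban1987RG1, Thm 1 p.259] -/
theorem s_N18_rRec₁₂_of_ofFixed
    (h : ∀ (F : T4Family) (θ : Stage12Params F N) (hP : θ.Provisos₁₂ F N), θ.Admissible F N → ∀ (g₀ : ℕ → ℝ) (os : List (ULoop F)),
      ∃ (C : Carriers) (EA : Functional C C.BgA) (EB : ℝ → Functional C C.BgB) (ℓ : U3Letters₁₁),
        (𝔯.lit F θ hP g₀ os).u3 = U3Objects₁₁.ofFixed C EA EB ℓ ∧
        N18At ⟨C, Window θ.γ, θ.γ, ℓ.κ, EA, EB, ℓ.θ₅, ℓ.C₅, ℓ.moduli, ℓ.C₉, ℓ.ω, ℓ.cr, ℓ.ρ⟩) :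
    S_N18 (RRec₁₂ 𝔯) := by
  refine s_N18_rRec₁₂_of_forall_admissible 𝔯 fun F θ hP hA g₀ os k => ?_
  obtain ⟨C, EA, EB, ℓ, hu, hN⟩ := h F θ hP hA g₀ os
  rw [hu]
  exact (n18At_level_ofFixed_iff C EA EB ℓ θ.γ k).2 hN

/-- **FIXED CARRIERS AT THE HOME, THE RECORD's LETTERS DOMINATING AN END's** [bookkeeping]: if at every admissible tuple with provisos and every `(g₀, os)`
the reading's U3 objects ARE `U3Objects₁₁.ofFixed v.C v.EA v.EB ℓ` for SOME U3 bundle `v` carrying `N18At v` (the H-layer END's bundle of module 1 ∕ 2,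
n18-a's primitive-rate bundle, …) whose window contains `]0, θ.γ]^ℕ` with radius `≥ θ.γ` and whose letters the record's dominate (`ℓ.κ ≤ v.κ`,
`0 ≤ v.θ ≤ ℓ.θ₅`, `0 ≤ v.C₅ ≤ ℓ.C₅`), then `S_N18 (RRec₁₂ 𝔯)` (module 4's `n18At_level_ofFixed_of_mono` at every level).
[cite: Balaban1987RG1, Thm 1 p.259 and (1.18) p.263] -/
theorem s_N18_rRec₁₂_of_ofFixed_mono
    (h : ∀ (F : T4Family) (θ : Stage12Params F N) (hP : θ.Provisos₁₂ F N), θ.Admissible F N → ∀ (g₀ : ℕ → ℝ) (os : List (ULoop F)),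
      ∃ (v : U3Carriers) (ℓ : U3Letters₁₁),
        (𝔯.lit F θ hP g₀ os).u3 = U3Objects₁₁.ofFixed v.C v.EA v.EB ℓ ∧ N18At v ∧
        Window θ.γ ⊆ v.W ∧ θ.γ ≤ v.γ ∧ ℓ.κ ≤ v.κ ∧ 0 ≤ v.θ ∧ v.θ ≤ ℓ.θ₅ ∧ 0 ≤ v.C₅ ∧ v.C₅ ≤ ℓ.C₅) :
    S_N18 (RRec₁₂ 𝔯) := by
  refine s_N18_rRec₁₂_of_forall_admissible 𝔯 fun F θ hP hA g₀ os k => ?_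
  obtain ⟨v, ℓ, hu, hv, hW, hγ, hκ, hθ, hθ', hC₅, hC⟩ := h F θ hP hA g₀ os
  rw [hu]
  obtain ⟨C, W, γv, κv, EAv, EBv, θv, C₅v, Λv, C₉v, ωv, crv, ρv⟩ := v
  exact n18At_level_ofFixed_of_mono ℓ k hv hW hγ hκ hθ hθ' hC₅ hC

/-! ## §3 The row: the H-layer END at the home, the NODE-A majorant as hypothesis -/

open Classical in
/-- **THE H-LAYER END AT THE RATE-RECORD HOME, WITH THE NODE-A MAJORANT AS HYPOTHESIS** [bookkeeping] — the row «knit `T4OutputRate.NE5` from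
`EnvelopeOnRecord*` faces at `RRec` ₁₁»: if at EVERY admissible Stage-11 tuple `θ` with provisos and every `(g₀, os)` the reading's U3 objects ARE the fixed
bundle `U3Objects₁₁.ofFixed Rr.carriers EA EB ℓ` of a two-run datum `Rr` (on any gauge group) for which, member by member `b ∈ ]0, γ′]` of run B's family,
step models `M b` represent `EA ∕ EB b` with (2.13) of activities `act b` as output (`hrep`), THE NODE-A MAJORANT HOLDS AS HYPOTHESIS (near every admissible
box an open set on which every activity is ℂ-differentiable with `‖act b j z Z‖ ≤ C₃ε₁·e^{−R_d·d_j(Z)}` — [II] Lemma 3 (2.38), instanced by nobody), the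
leaves L01–L03, L05–L09unit, the located numerals, the [KP86] clause, the reach clause L10 and the sharp clause hold on a window `W ⊇ ]0, θ.γ]^ℕ` of radius
`γ′ ≥ θ.γ` (module 1's binder list VERBATIM), and the record's letters dominate the END's (`ℓ.κ ≤ κ`, `θ′ ≤ ℓ.θ₅`, `C₅(C₃ε₁) ≤ ℓ.C₅`), then
`S_N18 (RRec₁₂ 𝔯)` — module 4's `n18At_level_ofFixed_of_envelopeOnRecord` (∘ module 1's `n18At_of_envelopeOnRecord` ∘ the END
`EnvelopeOnRecord.ne5_of_leaves_fibre_activities_record_eps`) ONCE per key and level.  The decidability instances of `locE` are the classical ones here.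
[cite: Balaban1988RG2Cluster, Lemma 3 (2.38) p.20 and (2.13) p.14; Balaban1987RG1, Thm 1 p.259] -/
theorem s_N18_rRec₁₂_of_envelopeOnRecord
    (h : ∀ (F : T4Family) (θ : Stage12Params F N) (hP : θ.Provisos₁₂ F N), θ.Admissible F N → ∀ (g₀ : ℕ → ℝ) (os : List (ULoop F)),
      ∃ (G : Type) (_ : GaugeGroup G) (Rr : TwoRuns G) (Op : Type) (_ : NormedAddCommGroup Op) (_ : NormedSpace ℂ Op)
        (Hist : Type) (_ : NormedAddCommGroup Hist) (_ : NormedSpace ℂ Hist) (M : ℝ → StepModel Rr.carriers Op Hist)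
        (act : ℝ → (j : ℕ) → Op × Hist → TDom 4 (Rr.cubesPerDir j) → ℂ) (W : Set (ℕ → ℝ)) (γ' C3 ε₁ Rd κ : ℝ)
        (EA : Functional Rr.carriers Rr.carriers.BgA) (EB : ℝ → Functional Rr.carriers Rr.carriers.BgB)
        (EA₀ E₀ E₁ δ δ' θr θ' cH ω ρ₀ B : ℝ) (k₀ : ℕ) (ℓ : U3Letters₁₁),
        (𝔯.lit F θ hP g₀ os).u3 = U3Objects₁₁.ofFixed Rr.carriers EA EB ℓ ∧
        (∀ b : ℝ, 0 < b → b ≤ γ' → ∀ (X : Rr.carriers.Dom) (z : Op × Hist),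
          (M b).Out X.1 z.1 z.2 X =
            locE (TTouch (d := 4) (N := Rr.cubesPerDir X.1)) (fun Z : (tsys 4 (Rr.cubesPerDir X.1)).Dom => Z.1) (act b X.1 z)
              X.2.1) ∧
        0 ≤ C3 ∧ 0 ≤ ε₁ ∧ 0 ≤ κ ∧ κ + 2 * (64 * Real.log 162) + 2 ≤ Rd ∧
        C3 * ε₁ * Real.exp (5 * κ + 1) * K₀ 64 8 * 9 * 64 ≤ 1 ∧
        (∀ b : ℝ, 0 < b → b ≤ γ' → ∀ j, ∀ g ∈ W, ∀ (U : Rr.carriers.BgB) (p : Op × Hist), p ∈ (M b).Base j g U →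
          ∃ V : Set (Op × Hist), IsOpen V ∧ (M b).box j p ⊆ V ∧
            (∀ Z : TDom 4 (Rr.cubesPerDir j), DifferentiableOn ℂ (fun z : Op × Hist => act b j z Z) V) ∧
            (∀ z ∈ V, ∀ Z : TDom 4 (Rr.cubesPerDir j), ‖act b j z Z‖ ≤ C3 * ε₁ * Real.exp (-(Rd * torusTreeLen Z.1)))) ∧
        (∀ b : ℝ, 0 < b → b ≤ γ' → L01 (M b) EA W) ∧ (∀ b : ℝ, 0 < b → b ≤ γ' → L02 (M b) (EB b) W) ∧
        (∀ b : ℝ, 0 < b → b ≤ γ' → L03 (M b) (EB b) W) ∧ L05 EA W EA₀ κ ∧ (∀ b : ℝ, 0 < b → b ≤ γ' → L06 (EB b) W E₀ κ) ∧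
        (∀ b : ℝ, 0 < b → b ≤ γ' → L07 (M b) W δ θr) ∧ (∀ b : ℝ, 0 < b → b ≤ γ' → L08 (M b) W κ E₀ δ' θr) ∧
        (∀ b : ℝ, 0 < b → b ≤ γ' → L09aff (M b) W) ∧ (∀ b : ℝ, 0 < b → b ≤ γ' → L09blind (M b) W) ∧
        (∀ b : ℝ, 0 < b → b ≤ γ' → L09hom (M b) W) ∧ (∀ b : ℝ, 0 < b → b ≤ γ' → L09unit (M b) W κ E₁ cH ω) ∧
        0 < E₁ ∧ 0 ≤ δ + δ' ∧ 0 ≤ θr ∧ θr ≤ θ' ∧ θ' ≤ 1 ∧ 0 ≤ cH ∧ 0 < ω ∧ ρ₀ < 1 ∧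
        (δ + δ') * θr ^ k₀ + cH * (EA₀ + E₀) / (1 - ω) ≤ ρ₀ ∧ 0 ≤ B ∧ (∀ k < k₀, EA₀ + E₀ ≤ B * θr ^ k) ∧
        Real.exp 1 * 9 * 64 * K₀ 64 8 ^ 2 * C3 * cH * ε₁ < (θ' - ω) * (1 - ρ₀) ∧
        Window θ.γ ⊆ W ∧ θ.γ ≤ γ' ∧ ℓ.κ ≤ κ ∧ θ' ≤ ℓ.θ₅ ∧
        (Real.exp 1 * 9 * 64 * K₀ 64 8 ^ 2 * (C3 * ε₁) / (1 - ρ₀) * (δ + δ') + B) * (θ' - ω) /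
            (θ' - (ω + Real.exp 1 * 9 * 64 * K₀ 64 8 ^ 2 * (C3 * ε₁) / (1 - ρ₀) * cH)) ≤ ℓ.C₅) :
    S_N18 (RRec₁₂ 𝔯) := by
  refine s_N18_rRec₁₂_of_forall_admissible 𝔯 fun F θ hP hA g₀ os k => ?_
  obtain ⟨G, _, Rr, Op, _, _, Hist, _, _, M, act, W, γ', C3, ε₁, Rd, κ, EA, EB, EA₀, E₀, E₁, δ, δ', θr, θ', cH, ω, ρ₀, B, k₀, ℓ, hu,
    hrep, hC3, hε₁, hκ, hrate, hKP, hH, l01, l02, l03, l05, l06, l07, l08, l09aff, l09blind, l09hom, l09unit, hE₁, hδ, hθ, hθθ', hθ'1,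
    hcH, hω, hρ₀, l10near, hB, l10first, hS, hW, hγ, hℓκ, hℓθ, hℓC⟩ := h F θ hP hA g₀ os
  rw [hu]
  exact n18At_level_ofFixed_of_envelopeOnRecord Rr M hrep hC3 hε₁ hκ hrate hKP hH l01 l02 l03 l05 l06 l07 l08 l09aff l09blind l09hom
    l09unit hE₁ hδ hθ hθθ' hθ'1 hcH hω hρ₀ l10near hB l10first hS ℓ hW hγ hℓκ hℓθ hℓC k

/-! ## §4 The tower reading at the home -/

/-- **THE TOWER READING AT THE RATE-RECORD HOME** [bookkeeping]: if at every admissible tuple with provisos and every `(g₀, os)` the reading's U3 objects ARE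
`t.objects ℓ` for an object tower `t : U3Tower₁₁` (ONE physical domain type, level `k` = scale `k − r X`, one ambient background type, transports `t.tr k`,
level functionals `t.E k`, run B through `prependCoupling`) and at EVERY level `k` some U3 bundle `v` with `N18At v` (an END's) is read through maps
`φD : t.Dom → v.C.Dom`, `φA φB : t.B → v.C.BgA ∕ v.C.BgB` preserving the level-`k` scale and the tree length and commuting with the transports, with
`t.E k` (at transported backgrounds) and `t.E (k+1) ∘ prependCoupling b` (`b ∈ ]0, θ.γ]`) AGREEING on `]0, θ.γ]^ℕ` with `v`'s functionals through the maps,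
and the record's letters dominating `v`'s, then `S_N18 (RRec₁₂ 𝔯)` — module 4's `n18At_level_tower_of_comap_agree` once per key and level.
[cite: Balaban1987RG1, (0.24)–(0.25) p.257, (1.18) p.263, Thm 1 p.259] -/
theorem s_N18_rRec₁₂_of_tower
    (h : ∀ (F : T4Family) (θ : Stage12Params F N) (hP : θ.Provisos₁₂ F N), θ.Admissible F N → ∀ (g₀ : ℕ → ℝ) (os : List (ULoop F)),
      ∃ (t : U3Tower₁₁) (ℓ : U3Letters₁₁), (𝔯.lit F θ hP g₀ os).u3 = t.objects ℓ ∧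
        ∀ k : ℕ, ∃ (v : U3Carriers) (φD : t.Dom → v.C.Dom) (φA : t.B → v.C.BgA) (φB : t.B → v.C.BgB),
          N18At v ∧ (∀ X, v.C.scale (φD X) = k - t.r X) ∧ (∀ X, v.C.d (φD X) = t.d X) ∧
          (∀ U, φA (t.tr k U) = v.C.transport (φB U)) ∧
          (∀ g ∈ Window θ.γ, ∀ (U : t.B) (X : t.Dom), t.E k g (t.tr k U) X = v.EA g (φA (t.tr k U)) (φD X)) ∧
          (∀ b : ℝ, 0 < b → b ≤ θ.γ → ∀ g ∈ Window θ.γ, ∀ (U : t.B) (X : t.Dom),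
            t.E (k + 1) (prependCoupling b g) U X = v.EB b g (φB U) (φD X)) ∧
          Window θ.γ ⊆ v.W ∧ θ.γ ≤ v.γ ∧ ℓ.κ ≤ v.κ ∧ 0 ≤ v.θ ∧ v.θ ≤ ℓ.θ₅ ∧ 0 ≤ v.C₅ ∧ v.C₅ ≤ ℓ.C₅) :
    S_N18 (RRec₁₂ 𝔯) := by
  refine s_N18_rRec₁₂_of_forall_admissible 𝔯 fun F θ hP hA g₀ os k => ?_
  obtain ⟨t, ℓ, hu, hk⟩ := h F θ hP hA g₀ os
  obtain ⟨v, φD, φA, φB, hv, hscale, hd, htr, hAg, hBg, hW, hγ, hκ, hθ, hθ', hC₅, hC⟩ := hk k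
  rw [hu]
  exact n18At_level_tower_of_comap_agree t ℓ θ.γ k v hv φD φA φB hscale hd htr hAg hBg hW hγ hκ hθ hθ' hC₅ hC

/-! ## §5 Located vacuity: the stub at the home certifies nothing by itself -/

/-- **LOCATED VACUITY** [honesty]: a reading whose level functionals VANISH identically (`u.EA k = 0`, `u.EB k b = 0` at every admissible tuple) with
nonnegative `θ₅`, `C₅` satisfies `S_N18 (RRec₁₂ 𝔯)` WITH NO ESTIMATE (`|0 − 0| ≤ C₅·θ₅^j·e^{−κ d}`).  So `S_N18` at the home is NE5's content exactly for
the PINNED reading — W1's (2.13) functionals of record — and nothing is certified over a residual `𝔯`; for other junk it is refutable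
(`YMDAG.N18.not_s_N18_of_admits`). [folklore] -/
theorem s_N18_rRec₁₂_of_null
    (h : ∀ (F : T4Family) (θ : Stage12Params F N) (hP : θ.Provisos₁₂ F N), θ.Admissible F N → ∀ (g₀ : ℕ → ℝ) (os : List (ULoop F)) (k : ℕ),
      (∀ g U X, (𝔯.lit F θ hP g₀ os).u3.EA k g U X = 0) ∧ (∀ b g U X, (𝔯.lit F θ hP g₀ os).u3.EB k b g U X = 0) ∧
      0 ≤ (𝔯.lit F θ hP g₀ os).u3.θ₅ ∧ 0 ≤ (𝔯.lit F θ hP g₀ os).u3.C₅) :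
    S_N18 (RRec₁₂ 𝔯) := by
  refine s_N18_rRec₁₂_of_forall_ne5 𝔯 fun F θ hP hA g₀ os k b _ _ g _ U X => ?_
  obtain ⟨hA0, hB0, hθ₅, hC₅⟩ := h F θ hP hA g₀ os k
  rw [hA0, hB0, sub_self, abs_zero]
  positivity

/-! ## §6 The reading in the definer's currency: NE5 for Bałaban's (2.13) terms of record (W1, `Node00/HistoryTermsOfRecord`) -/

section W1Currency

variable {P P' : Params} {𝔸 : Type*} {M M' : ℕ} (S : Node00.W1.ClusterTower P 𝔸 M) (S' : Node00.W1.ClusterTower P' 𝔸 M')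
variable {BA BB : Type} (gauge : BA → BA → ℝ) (hg : ∀ U U', 0 ≤ gauge U U') (tr : BB → BA)
variable (embA : BA → Node00.Sect2.CPair P 𝔸) (embB : BB → Node00.Sect2.CPair P' 𝔸) (π : Node00.W1.Dom P M → Node00.W1.Dom P' M')
variable (ℓ : U3Letters₁₁) {F : T4Family} (θ : Stage12Params F N) (k : ℕ)

/-- **N18 AT THE HOME IN W1's CURRENCY — WHAT NE5 SAYS FOR BAŁABAN's (2.13) TERMS OF RECORD** (`Iff.rfl`).  Objects: run A's tower of one-step cluster
data `S` on the torus parameters `P` (its terms `E^{(j)}(X; g₀,…,g_{j−1}; (𝐔,𝐉))` = `Node00.W1.functionalC S`, (2.13) AS A DEFINITION), run B's tower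
`S′` on `P′`, and the UNPRINTED two-run pairing data W1 leaves to the N18 side, here PARAMETERS: run-A ∕ run-B background types `BA ∕ BB` with their
readings `embA ∕ embB` in the configuration types `Φ`, the closeness gauge, the one-step transport `tr : BB → BA`, and the domain pairing
`π : (j, X) ↦` run B's domain of the same physical extent (nothing about `π` is required by the statement — scale and tree length are read on run A's
`(j, X)`).  Then N18 at the bundle of record of the fixed-carrier U3 objects `ofFixed (histCarriers P M ⟨BA, BB, gauge, tr⟩) (functionalOn S … embA)
(b g U X ↦ Re E_B(πX; b∷g; embB U)) ℓ` at ANY level `k` IS: for every member `b ∈ ]0, θ.γ]`, every history `g ∈ ]0, θ.γ]^ℕ`, every run-B background `U`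
and every run-A domain `(j, X)`,
`|Re E_A^{(j)}(X; g; embA (tr U)) − Re E_B(πX; b∷g; embB U)| ≤ ℓ.C₅ · ℓ.θ₅ ^ j · e^{−ℓ.κ·d_j(X)}` — the η-rate of the one-step outputs as functionals of
the background, BY NAME on the definer's objects.  PINNING the reading `𝔯` to these objects is nobody's yet (LOCATED); proving the inequality is N18's
estimate (NOT in print). [cite: Balaban1988RG2Cluster, (2.13) p.14; Balaban1987RG1, (0.24)–(0.25) p.257, (1.18) p.263 and Thm 1 p.259] -/
theorem n18At_u3OfRecord₁₂_histCarriers_iff :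
    N18At (u3OfRecord₁₂ θ (U3Objects₁₁.ofFixed (Node00.W1.histCarriers P M ⟨BA, BB, gauge, hg, tr⟩)
      (Node00.W1.functionalOn S ⟨BA, BB, gauge, hg, tr⟩ embA)
      (fun b g U X => (Node00.W1.functionalC S' (prependCoupling b g) (embB U) (π X)).re) ℓ) k) ↔
    ∀ b : ℝ, 0 < b → b ≤ θ.γ → ∀ g ∈ Window θ.γ, ∀ (U : BB) (X : Node00.W1.Dom P M),
      |(Node00.W1.functionalC S g (embA (tr U)) X).re - (Node00.W1.functionalC S' (prependCoupling b g) (embB U) (π X)).re| ≤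
        ℓ.C₅ * ℓ.θ₅ ^ X.1 * Real.exp (-(ℓ.κ * (Node00.Sect2.domSys P M X.1).dj X.2)) :=
  Iff.rfl

end W1Currency

/-- **`S_N18` AT THE HOME FOR A READING PINNED TO W1's OBJECTS** [bookkeeping]: if at every admissible Stage-11 tuple with provisos and every `(g₀, os)` the
reading's U3 objects ARE the fixed-carrier objects of §6 for some towers of one-step cluster data `S ∕ S′` (runs A ∕ B), pairing data and letter block `ℓ`,
AND the displayed η-rate inequality holds for their (2.13) terms on `]0, θ.γ]`, then `S_N18 (RRec₁₂ 𝔯)`.  The first conjunct is the definer's PIN (nobody's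
yet); the second is NE5's content for Bałaban's terms — by §3 it follows from NODE A's (2.38) majorant through the H-layer END once the towers carry the
END's step-model representation; neither is asserted here. [cite: Balaban1988RG2Cluster, (2.13) p.14 and Lemma 3 (2.38) p.20; Balaban1987RG1, Thm 1 p.259] -/
theorem s_N18_rRec₁₂_of_histCarriers
    (h : ∀ (F : T4Family) (θ : Stage12Params F N) (hP : θ.Provisos₁₂ F N), θ.Admissible F N → ∀ (g₀ : ℕ → ℝ) (os : List (ULoop F)),
      ∃ (P P' : Params) (𝔸 : Type) (M M' : ℕ) (S : Node00.W1.ClusterTower P 𝔸 M) (S' : Node00.W1.ClusterTower P' 𝔸 M')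
        (BA BB : Type) (gauge : BA → BA → ℝ) (hg : ∀ U U', 0 ≤ gauge U U') (tr : BB → BA)
        (embA : BA → Node00.Sect2.CPair P 𝔸) (embB : BB → Node00.Sect2.CPair P' 𝔸) (π : Node00.W1.Dom P M → Node00.W1.Dom P' M')
        (ℓ : U3Letters₁₁),
        (𝔯.lit F θ hP g₀ os).u3 = U3Objects₁₁.ofFixed (Node00.W1.histCarriers P M ⟨BA, BB, gauge, hg, tr⟩)
          (Node00.W1.functionalOn S ⟨BA, BB, gauge, hg, tr⟩ embA)
          (fun b g U X => (Node00.W1.functionalC S' (prependCoupling b g) (embB U) (π X)).re) ℓ ∧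
        ∀ b : ℝ, 0 < b → b ≤ θ.γ → ∀ g ∈ Window θ.γ, ∀ (U : BB) (X : Node00.W1.Dom P M),
          |(Node00.W1.functionalC S g (embA (tr U)) X).re - (Node00.W1.functionalC S' (prependCoupling b g) (embB U) (π X)).re| ≤
            ℓ.C₅ * ℓ.θ₅ ^ X.1 * Real.exp (-(ℓ.κ * (Node00.Sect2.domSys P M X.1).dj X.2))) :
    S_N18 (RRec₁₂ 𝔯) := by
  refine s_N18_rRec₁₂_of_forall_admissible 𝔯 fun F θ hP hA g₀ os k => ?_
  obtain ⟨P, P', 𝔸, M, M', S, S', BA, BB, gauge, hg, tr, embA, embB, π, ℓ, hu, hN⟩ := h F θ hP hA g₀ os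
  rw [hu]
  exact (n18At_u3OfRecord₁₂_histCarriers_iff S S' gauge hg tr embA embB π ℓ θ k).2 hN

/-! ## §7 At the home through ANY transport of record (module 6, LENS card T1) -/

/-- **AT THE STAGE-12 HOME THE KNIT DOES NOT DEPEND ON THE TRANSPORT OF RECORD** [bookkeeping]: if at every admissible Stage-12 tuple with provisos and every
`(g₀, os)` the reading's U3 objects ARE `U3Objects₁₁.ofFixed v.C v.EA v.EB ℓ` for SOME U3 bundle `v` whose NE5 is known THROUGH ANOTHER TRANSPORT `T′` of its run-B
backgrounds (`N18At` at `{ v.C with transport := T' }` — e.g. an END proved through the datum's block averaging (§8) while the definer's objects carry W1's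
`RunPairing.transport`), together with run A's background-Lipschitz bracket `LipBackground v.EA v.W v.κ CU` ([III] (2.27)(ii), displayed), the COHERENCE LETTER
`CU g k · gauge(transport U, T′ U) ≤ D·θ^k` (displayed; instances are printed-kind facts, literature lane) and the record's letters dominating (`Window θ.γ ⊆ v.W`,
`θ.γ ≤ v.γ`, `ℓ.κ ≤ v.κ`, `0 ≤ v.θ ≤ ℓ.θ₅`, `0 ≤ v.C₅ + D ≤ ℓ.C₅`), then `S_N18 (RRec₁₂ 𝔯)` — module 6's `n18At_of_transport_swap`, then §2.
[cite: Balaban1987RG1, Thm 1 p.259; Balaban1988Convergent, (2.27)(ii) p.259] -/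
theorem s_N18_rRec₁₂_of_ofFixed_transport_swap
    (h : ∀ (F : T4Family) (θ : Stage12Params F N) (hP : θ.Provisos₁₂ F N), θ.Admissible F N → ∀ (g₀ : ℕ → ℝ) (os : List (ULoop F)),
      ∃ (v : U3Carriers) (T' : v.C.BgB → v.C.BgA) (CU : (ℕ → ℝ) → ℕ → ℝ) (D : ℝ) (ℓ : U3Letters₁₁),
        (𝔯.lit F θ hP g₀ os).u3 = U3Objects₁₁.ofFixed v.C v.EA v.EB ℓ ∧
        N18At ⟨{ v.C with transport := T' }, v.W, v.γ, v.κ, v.EA, v.EB, v.θ, v.C₅, v.Λ, v.C₉, v.ω, v.cr, v.ρ⟩ ∧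
        LipBackground v.EA v.W v.κ CU ∧
        (∀ g ∈ v.W, ∀ (U : v.C.BgB) (k : ℕ), CU g k * v.C.gauge (v.C.transport U) (T' U) ≤ D * v.θ ^ k) ∧
        Window θ.γ ⊆ v.W ∧ θ.γ ≤ v.γ ∧ ℓ.κ ≤ v.κ ∧ 0 ≤ v.θ ∧ v.θ ≤ ℓ.θ₅ ∧ 0 ≤ v.C₅ + D ∧ v.C₅ + D ≤ ℓ.C₅) :
    S_N18 (RRec₁₂ 𝔯) := by
  refine s_N18_rRec₁₂_of_ofFixed_mono 𝔯 fun F θ hP hA g₀ os => ?_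
  obtain ⟨v, T', CU, D, ℓ, hu, hN, hU, hT, hW, hγ, hκ, hθ, hθ', hC₅, hC⟩ := h F θ hP hA g₀ os
  obtain ⟨C, W, γv, κv, EAv, EBv, θv, C₅v, Λv, C₉v, ωv, crv, ρv⟩ := v
  exact ⟨⟨C, W, γv, κv, EAv, EBv, θv, C₅v + D, Λv, C₉v, ωv, crv, ρv⟩, ℓ, hu, n18At_of_transport_swap T' hN hU hT, hW, hγ, hκ, hθ,
    hθ', hC₅, hC⟩

/-! ## §8 The datum-keyed two-run carriers at a Stage-12 datum key: the transport IS Bałaban's block averaging -/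

/-- **AT A STAGE-12 DATUM KEY THE DATUM-KEYED TRANSPORT IS BAŁABAN's (0.4) BLOCK AVERAGING** [bookkeeping] — module 1 §3's
`datumCarriers_transport_of_isRecordOfRecord₁₁C` RE-KEYED (its ₁₁ hypothesis is uninhabited): for `hk : Node00.IsDatumOfRecord₁₂C F N D` the datum IS
`datumOfRecord₁₂ F N hk.params hk.provisos`, whose averaging is `Node00.avOfRecord F N` (RR-2's `IsDatumOfRecord₁₂C.av_eq`), so the run B → run A transport of the
datum-keyed two-run carriers `⟨F, K, m′, D.av (K+1) 0, admA, admB, hmaps⟩ : TwoRuns (SU N)` — by `TwoRuns.carriers_transport_val` the raw transport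
`transportRaw F K (D.av (K+1) 0)` — IS `transportRaw F K (blockAvg expMeanLogSU)`: the printed centred block averaging with inner operation exp[mean log] on `SU(N)`
followed by the level identification.  This is the END's transport `T′` of §7 when the definer's objects carry another one. [cite: Balaban1987RG1, (0.4) p.253] -/
theorem datumCarriers_transport_of_isDatumOfRecord₁₂C {F : T4Family} {D : Datum F N} (hk : IsDatumOfRecord₁₂C F N D) (K m' : ℕ)
    (admA : Set (GaugeField (F.P K) 0 (Node00.SU N))) (admB : Set (GaugeField (F.P (K + 1)) 0 (Node00.SU N)))
    (hmaps : Set.MapsTo (transportRaw F K (D.av (K + 1) 0)) admB admA)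
    (U : (⟨F, K, m', D.av (K + 1) 0, admA, admB, hmaps⟩ : TwoRuns (Node00.SU N)).carriers.BgB) :
    ((⟨F, K, m', D.av (K + 1) 0, admA, admB, hmaps⟩ : TwoRuns (Node00.SU N)).carriers.transport U).1 =
      transportRaw F K (BlockAveraging.blockAvg ExpMeanLog.expMeanLogSU) U.1 := by
  have h2 : transportRaw F K (D.av (K + 1) 0) = transportRaw F K (BlockAveraging.blockAvg ExpMeanLog.expMeanLogSU) := by
    rw [hk.av_eq]
    rfl
  exact (TwoRuns.carriers_transport_val _ U).trans (congrFun h2 U.1)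

/-! ## §9 Refutability restored at ₁₂ (modulo K0′): the stub at the Stage-12 home is NOT closed by shape -/

/-- **THE UNIT-GAP BUNDLE ON A WINDOW** [decided toy; `BalabanUVNodesN18AtRecord.not_n18At_unit_gap` at the home's window shape]: at the countable carriers
`Dom := ℕ` (creation scale = the index, tree length `0`, trivial backgrounds, transport `id`), window `]0, γ]^ℕ` with radius `γ > 0`, run A's functional `≡ 0`
and run B's family `≡ 1`, rate `½`: `N18At` FAILS for EVERY constant `C₅` — `C₅·(½)^j < 1 = |0 − 1|` at a large scale `j`, tested at the member `b = γ` and the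
constant history `γ`. [folklore] -/
theorem not_n18At_unit_gap_window {γ : ℝ} (hγ : 0 < γ) (κ C₅ : ℝ) (Λ : ℕ → ℕ → ℝ) (C₉ ω cr ρ : ℝ) :
    ¬ N18At ⟨{ Dom := ℕ, scale := fun j => j, d := fun _ => 0, d_nonneg := fun _ => le_rfl, BgA := PUnit, BgB := PUnit,
                  gauge := fun _ _ => 0, gauge_nonneg := fun _ _ => le_rfl, transport := id },
               Window γ, γ, κ, fun _ _ _ => 0, fun _ _ _ _ => 1, 1 / 2, C₅, Λ, C₉, ω, cr, ρ⟩ := by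
  intro h
  -- a scale `j` with `C₅·(½)^j < 1`
  obtain ⟨j, hj⟩ : ∃ j : ℕ, C₅ * (1 / 2 : ℝ) ^ j < 1 := by
    by_cases hC : 0 < C₅
    · obtain ⟨j, hj⟩ := exists_pow_lt_of_lt_one (inv_pos.mpr hC) (by norm_num : (1 / 2 : ℝ) < 1)
      refine ⟨j, ?_⟩
      calc C₅ * (1 / 2 : ℝ) ^ j < C₅ * C₅⁻¹ := mul_lt_mul_of_pos_left hj hC
        _ = 1 := mul_inv_cancel₀ hC.ne'
    · exact ⟨0, by simp only [pow_zero, mul_one]; linarith⟩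
  have hg : (fun _ : ℕ => γ) ∈ Window γ := fun _ => ⟨hγ, le_rfl⟩
  have hb := h γ hγ le_rfl (fun _ => γ) hg PUnit.unit j
  have hval : |(0 : ℝ) - 1| = 1 := by norm_num
  have hrhs : C₅ * (1 / 2 : ℝ) ^ j * Real.exp (-(κ * 0)) = C₅ * (1 / 2 : ℝ) ^ j := by
    rw [mul_zero, neg_zero, Real.exp_zero, mul_one]
  have hb' : (1 : ℝ) ≤ C₅ * (1 / 2 : ℝ) ^ j := by
    have := hb
    rw [hval, hrhs] at this
    exact this
  linarith

/-- **REFUTABILITY RESTORED AT THE STAGE-12 HOME, MODULO K0′** [honesty]: whereas at ₁₁ EVERY reading satisfies `S_N18 (RRec₁₁ 𝔯)` with no estimate (the ₁₁ key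
is empty — n22-e's `k4_rRec₁₁_outright`), at ₁₂ the stub is NOT closed by shape: if SOME Stage-12 datum key is inhabited (the body of K0′ at one family), then
next to any reading `𝔯₀` there is a reading — `𝔯₀`'s own NE1′ ∕ NE2 ∕ NE3 components, its U3 objects replaced by the unit-gap fixed bundle of
`not_n18At_unit_gap_window` — over which `S_N18 (RRec₁₂ ·)` FAILS (`BalabanUVNodesN18AtRecord.not_s_N18_of_admits` at the run-length-`0` bundle of the inhabited
key).  So `S_N18` at the ₁₂ home is a statement about the PINNED reading's functionals and rate letter — content for W1's (2.13) terms, nothing by shape.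
[folklore] -/
theorem exists_not_s_N18_rRec₁₂_of_inhabited (𝔯₀ : RateReading₁₂ N) (hK0 : ∃ (F : T4Family) (D : Datum F N), IsDatumOfRecord₁₂C F N D) :
    ∃ 𝔯' : RateReading₁₂ N, ¬ S_N18 (RRec₁₂ 𝔯') := by
  obtain ⟨F, D, hk⟩ := hK0
  let ℓ : U3Letters₁₁ := ⟨0, 1 / 2, 1, 0, 0, 0, 1 / 2⟩
  let ubad : U3Objects₁₁ :=
    U3Objects₁₁.ofFixed
      { Dom := ℕ, scale := fun j => j, d := fun _ => 0, d_nonneg := fun _ => le_rfl, BgA := PUnit, BgB := PUnit,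
        gauge := fun _ _ => 0, gauge_nonneg := fun _ _ => le_rfl, transport := id }
      (fun _ _ _ => 0) (fun _ _ _ _ => 1) ℓ
  let 𝔯' : RateReading₁₂ N := ⟨fun F θ hP g₀ os => { 𝔯₀.lit F θ hP g₀ os with u3 := ubad }, 𝔯₀.ne1⟩
  refine ⟨𝔯', YMDAG.N18.not_s_N18_of_admits (RRec₁₂ 𝔯') ⟨F, D, fun _ => 0, [], _, rRec₁₂_self 𝔯' hk (fun _ => 0) [] 0, ?_⟩⟩
  exact not_n18At_unit_gap_window hk.gamma_pos 0 1 ℓ.moduli 0 0 0 (1 / 2)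

end YMDAG.N18.HLayer

end
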